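import Literature.NumberTheory.EllipticCurves.JZeroTwoPowerTorsionGaloisLine
import HarnessLib

/-!
# Kummer theory on the `2`-power Galois line of a `j = 0` curve: classes are detected, and their values
# prescribed, by Galois elements fixing the torsion of a SECOND curve

Topic `NumberTheory/EllipticCurves`; namespace `Literature.NumberTheory.EllipticCurves.JZero`. THEOREMS ONLY: **no
definition and no named fact** (D-0026). Sequel of `JZeroTwoPowerTorsionGaloisLine` ((α) `σ = a + b·fn`, (γ) h1Eval
faithfulness) — the level-`2^M` form of Gross 1991 Prop. 9.3 / Rubin 1999 Lemma 6.3 («`Gal(L_S/K(E[p^M])) ≅ Hom(S, E[p^M])`»),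
which the tree has at PRIME level only (`HeegnerPointsKolyvaginPairingCM*`: `E[p]` simple). Setting: `E = W/K`, `n = 2^M`,
`fn` on `E[n]` with `fn² + fn + 1 = 0`, `Γ_K`-equivariant, no non-zero `Γ_K`-fixed vector (`hnofix`); `wH` on `H¹(K, E[n])`
over `fn` (`[wH x, ρ] = fn [x, ρ]`, the tree's `forall_h1Eval_resH1Hom_id`); a subgroup `N ≤ Γ_K` receiving all
commutators (`g ρ g⁻¹ ρ⁻¹ ∈ N`; e.g. `N = Γ_{K(B[n])}` for a second such curve `B`, by (α)). `[x, ρ] := h1Eval`.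
* `eq_zero_of_forall_h1Eval_inf_eq_zero`: a class vanishing on `Γ_{K(E[n])} ∩ N` is `0` ((γ) + abelian image + hnofix).
* `exists_h1Eval_eq_zsmul_add_of_ker` (the SCALAR LEMMA): on a conjugation-stable `G' ≤ Γ_{K(E[n])}`, a class `c` with
  `ker [h, ·] ⊆ ker [c, ·]` is `a·[h, ·] + b·fn [h, ·]` — the values of `h` on `G'` form an `𝒪/2^M`-submodule of the
  LINE, i.e. a cyclic one, and a `Γ_K`-equivariant additive map on it is a scalar of `𝒪 = ℤ[fn]`.
* ★ `mem_closure_of_forall_h1Eval_eq_zero` (DOUBLE ANNIHILATOR): a class vanishing at every `ρ ∈ Γ_{K(E[n])} ∩ N` that kills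
  a finite `T` lies in the `𝒪`-span `closure (T ∪ wH '' T)` (induction on `T` by the scalar lemma).
* ★ `exists_h1Eval_eq_of_closure` (PRESCRIBED VALUE): for `h`, `T` and a target `u` killed by the `𝒪`-annihilator of `h`
  modulo the span of `T`, some `ρ ∈ Γ_{K(E[n])} ∩ N` kills `T` and has `[h, ρ] = u`.
D440: `hnofix` is genuine (for the split torsion `E[n] ≅ (ℤ/n)²` with trivial action every class vanishes on
`Γ_{K(E[n])} = Γ_K`-cocycles… and the double annihilator fails); `hcommN` is what makes ONE element serve two curves.

References: [Rubin1999] K. Rubin, *Elliptic curves with complex multiplication and the conjecture of Birch and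
Swinnerton-Dyer*, LNM 1716 (1999), Lemma 6.2, Lemma 6.3, Prop. 6.5; [GrossLMS1991] B. H. Gross, *Kolyvagin's work on
modular elliptic curves* (1991), §9 Prop. 9.3; [McCallumLMS1991] W. G. McCallum, *Kolyvagin's work on Shafarevich–Tate
groups* (1991), §3 (2), §5 Prop. 5.2.
-/

noncomputable section

open scoped Classical

universe u

namespace Literature.NumberTheory.EllipticCurves.JZero

open _root_.WeierstrassCurve Field CMTorsionLine

variable {K : Type u} [Field K] [CharZero K] (W : WeierstrassCurve K) [W.IsElliptic] (n : ℕ) [NeZero n] {M : ℕ}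

omit [CharZero K] [W.IsElliptic] [NeZero n] in
/-- `[x, ρ ^ m] = m • [x, ρ]` on `Γ_{K(E[n])}` for `m : ℤ` (`ρ ↦ [x, ρ]` is a homomorphism there).
[cite: GrossLMS1991, Prop. 9.1] -/
theorem h1Eval_zpow_of_mem (x : galH1Torsion W (n : ℤ)) {ρ : absoluteGaloisGroup K}
    (hρ : ρ ∈ torsionFixing W (n : ℤ)) (m : ℤ) : h1Eval W (n : ℤ) x (ρ ^ m) = m • h1Eval W (n : ℤ) x ρ := by
  have hnat : ∀ k : ℕ, h1Eval W (n : ℤ) x (ρ ^ k) = (k : ℤ) • h1Eval W (n : ℤ) x ρ := fun k ↦ by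
    induction k with
    | zero => rw [pow_zero, h1Eval_one, Nat.cast_zero, zero_smul]
    | succ k ih => rw [pow_succ, h1Eval_mul W (n : ℤ) x (Subgroup.pow_mem _ hρ k), ih, Nat.cast_succ, add_smul, one_smul]
  cases m with
  | ofNat k => rw [Int.ofNat_eq_natCast, zpow_natCast, hnat]
  | negSucc k =>
    rw [zpow_negSucc, h1Eval_inv W (n : ℤ) x (Subgroup.pow_mem _ hρ _), hnat, Int.negSucc_eq, neg_smul, Nat.cast_succ]

/-- **Cancelling an odd integer on a `2^M`-torsion group**: `(u * b) • x = x` for some `u`, whenever `2^M • x = 0`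
(`b` is a unit mod `2^M`). [cite: Rubin1999, Lemma 6.2 (i)] -/
theorem _root_.Literature.NumberTheory.EllipticCurves.CMTorsionLine.exists_mul_odd_zsmul_eq
    {X : Type*} [AddCommGroup X] (M : ℕ) {b : ℤ} (hb : ¬ (2 : ℤ) ∣ b) :
    ∃ u : ℤ, ∀ x : X, ((2 : ℤ) ^ M) • x = 0 → (u * b) • x = x := by
  have hodd : Odd b := Int.not_even_iff_odd.mp (by rwa [even_iff_two_dvd])
  obtain ⟨k, hk⟩ := hodd
  have hcop : IsCoprime b ((2 : ℤ) ^ M) := IsCoprime.pow_right ⟨1, -k, by rw [hk]; ring⟩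
  obtain ⟨u, v, huv⟩ := hcop
  refine ⟨u, fun x hx ↦ ?_⟩
  calc (u * b) • x = (u * b) • x + v • (((2 : ℤ) ^ M) • x) := by rw [hx, smul_zero, add_zero]
    _ = (u * b + v * (2 : ℤ) ^ M) • x := by rw [add_smul, mul_smul v]
    _ = x := by rw [huv, one_smul]

omit [NeZero n] in
/-- **The `2^k`-torsion of `E[2^M]` is spanned over `ℤ[fn]` by any of its elements of exact order `2^k`** (it is the line
`E[2^k]`, free of rank one over `(ℤ/2^k)[fn]`; (α) of the Galois-line file at level `2^k`, transported along
`E[2^M][2^k] ≃ E[2^k]`). [cite: Rubin1999, Cor. 5.5] [cite: SilvermanAEC2009, Cor. III.6.4(b)] -/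
theorem exists_eq_zsmul_add_zsmul_fn_of_two_pow (fn : geomTorsion W (n : ℤ) →+ geomTorsion W (n : ℤ)) (hn : n = 2 ^ M)
    (hrel : ∀ Q, fn (fn Q) + fn Q + Q = 0) {k : ℕ} (hkM : k ≤ M)
    {v : geomTorsion W (n : ℤ)} (hv : ((2 : ℤ) ^ k) • v = 0) (hv' : ((2 : ℤ) ^ (k - 1)) • v ≠ 0)
    {y : geomTorsion W (n : ℤ)} (hy : ((2 : ℤ) ^ k) • y = 0) : ∃ a b : ℤ, y = a • v + b • fn v := by
  -- the subgroup `X' = E[2^M][2^k]` with `fn` restricted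
  set X' : AddSubgroup (geomTorsion W (n : ℤ)) := AddSubgroup.torsionBy (geomTorsion W (n : ℤ)) ((2 : ℤ) ^ k) with hX'
  have hmem : ∀ {Q : geomTorsion W (n : ℤ)}, Q ∈ X' ↔ ((2 : ℤ) ^ k) • Q = 0 := fun {Q} ↦
    Submodule.mem_torsionBy_iff ((2 : ℤ) ^ k) Q
  let fnk : X' →+ X' := (fn.comp X'.subtype).codRestrict X' fun Q ↦ by
    rw [hmem, AddMonoidHom.coe_comp, AddSubgroup.coe_subtype, Function.comp_apply, ← map_zsmul, hmem.mp Q.2, map_zero]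
  have hrelk : ∀ Q : X', fnk (fnk Q) + fnk Q + Q = 0 := fun Q ↦ Subtype.ext (hrel Q)
  have hkillk : ∀ Q : X', ((2 : ℤ) ^ k) • Q = 0 := fun Q ↦ Subtype.ext (hmem.mp Q.2)
  have hP₀ : ((2 : ℤ) ^ (k - 1)) • (⟨v, hmem.mpr hv⟩ : X') ≠ 0 := fun h ↦ hv' (congrArg Subtype.val h)
  -- `|E[2^M][2^k]| = |E[2^k]| = 4^k`
  have hcard : Nat.card X' = 2 ^ k * 2 ^ k := by
    have hdvd : ((2 ^ k : ℕ) : ℤ) ∣ (n : ℤ) := by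
      rw [hn]; exact_mod_cast pow_dvd_pow 2 hkM
    obtain ⟨d, hd⟩ := hdvd
    let e : X' ≃ geomTorsion W ((2 ^ k : ℕ) : ℤ) :=
      { toFun := fun Q ↦ ⟨((Q : geomTorsion W (n : ℤ)) : geomPoints W), by
          rw [mem_geomTorsion_iff, Nat.cast_pow, Nat.cast_ofNat, ← AddSubgroupClass.coe_zsmul, hmem.mp Q.2,
            ZeroMemClass.coe_zero]⟩
        invFun := fun P ↦ ⟨⟨(P : geomPoints W), by
          have h2 : (((2 ^ k : ℕ) : ℤ)) • (P : geomPoints W) = 0 := (mem_geomTorsion_iff _ _ _).mp P.2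
          have h3 : (n : ℤ) • (P : geomPoints W) = 0 := by rw [hd, mul_comm, mul_smul, h2, smul_zero]
          exact (mem_geomTorsion_iff _ _ _).mpr h3⟩, by
          rw [hmem]; apply Subtype.ext
          rw [AddSubgroupClass.coe_zsmul, ZeroMemClass.coe_zero]
          have h2 := (mem_geomTorsion_iff _ _ _).mp P.2
          have hc : ((2 : ℤ) ^ k) = ((2 ^ k : ℕ) : ℤ) := by norm_cast
          rw [hc]; exact h2⟩
        left_inv := fun Q ↦ rfl
        right_inv := fun P ↦ rfl }
    rw [Nat.card_congr e, natCard_geomTorsion_eq_mul]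
  obtain ⟨a, b, hab⟩ := CMTorsionLine.exists_eq_zsmul_add_zsmul_fn fnk hrelk hkillk hP₀ hcard ⟨y, hmem.mpr hy⟩
  have e := congrArg Subtype.val hab
  simp only [AddSubgroup.coe_add, AddSubgroupClass.coe_zsmul] at e
  exact ⟨a, b, e⟩

section Kummer

variable (fn : geomTorsion W (n : ℤ) →+ geomTorsion W (n : ℤ)) (hn : n = 2 ^ M) (hM : 1 ≤ M)
  (hrel : ∀ Q, fn (fn Q) + fn Q + Q = 0)
  (hfn : ∀ (g : absoluteGaloisGroup K) (Q : geomTorsion W (n : ℤ)), fn (g • Q) = g • fn Q)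
  (hnofix : ∀ Q : geomTorsion W (n : ℤ), (∀ g : absoluteGaloisGroup K, g • Q = Q) → Q = 0)
include hn hM hrel hfn hnofix

/-- **Some `σ ∈ Γ_K` acts on `E[2^M]` as `a + b·fn` with `b` ODD** (else every `σ` fixes the `2`-torsion, against
`hnofix`). [cite: Rubin1999, Lemma 6.2 (i)] -/
theorem exists_smul_eq_zsmul_add_odd_zsmul_fn : ∃ (σ : absoluteGaloisGroup K) (a b : ℤ),
    (∀ Q : geomTorsion W (n : ℤ), σ • Q = a • Q + b • fn Q) ∧ ¬ (2 : ℤ) ∣ b := by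
  by_contra hcon
  push Not at hcon
  obtain ⟨P₀, hP₀⟩ := exists_two_pow_pred_zsmul_ne_zero W n hn hM
  set R := ((2 : ℤ) ^ (M - 1)) • P₀ with hRdef
  have hR2 : (2 : ℤ) • R = 0 := by
    rw [hRdef, smul_smul, ← pow_succ', Nat.sub_add_cancel hM]; exact two_pow_zsmul_geomTorsion W n hn P₀
  have hfR2 : (2 : ℤ) • fn R = 0 := by rw [← map_zsmul, hR2, map_zero]
  refine hP₀ (hnofix R fun g ↦ ?_)
  obtain ⟨a, b, hab⟩ := smul_eq_zsmul_add_zsmul_fn W n fn hn hM hrel hfn g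
  obtain ⟨b', rfl⟩ := hcon g a b hab
  have hgR : g • R = a • R := by rw [hab, mul_comm (2 : ℤ) b', mul_smul, hfR2, smul_zero, add_zero]
  obtain ⟨c, hc | hc⟩ := Int.even_or_odd' a
  · -- `a` even: `g • R = 0`, so `R = 0`
    have h0 : R = 0 := (smul_eq_zero_iff_eq g).mp (by rw [hgR, hc, mul_comm (2 : ℤ) c, mul_smul, hR2, smul_zero])
    rw [h0, smul_zero]
  · rw [hgR, hc, add_smul, mul_comm (2 : ℤ) c, mul_smul, hR2, smul_zero, zero_add, one_smul]

/-- **A class vanishing on `Γ_{K(E[2^M])} ∩ N` is zero**, for any `N ≤ Γ_K` containing all commutators: `[s, ρ]` is then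
`Γ_K`-invariant for every `ρ ∈ Γ_{K(E[2^M])}` (`[s, gρg⁻¹] = g • [s, ρ]`, and `gρg⁻¹ρ⁻¹ ∈ Γ_{K(E[2^M])} ∩ N`), hence `0`
by `hnofix`, and (γ) concludes. Replaces the prime-level exponent trick of `exists_h1Eval_eq_of_comm_of_pow_mem`.
[cite: GrossLMS1991, Prop. 9.3] [cite: Rubin1999, Prop. 6.5] -/
theorem eq_zero_of_forall_h1Eval_inf_eq_zero (N : Subgroup (absoluteGaloisGroup K))
    (hcommN : ∀ g ρ : absoluteGaloisGroup K, g * ρ * g⁻¹ * ρ⁻¹ ∈ N) {s : galH1Torsion W (n : ℤ)}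
    (hs : ∀ ρ ∈ torsionFixing W (n : ℤ) ⊓ N, h1Eval W (n : ℤ) s ρ = 0) : s = 0 := by
  refine eq_zero_of_forall_h1Eval_eq_zero_two_pow W n fn hn hM hrel hfn hnofix fun ρ hρ ↦ hnofix _ fun g ↦ ?_
  have hc : g * ρ * g⁻¹ * ρ⁻¹ ∈ torsionFixing W (n : ℤ) ⊓ N :=
    ⟨Subgroup.mul_mem _ ((torsionFixing_normal W (n : ℤ)).conj_mem ρ hρ g) (Subgroup.inv_mem _ hρ), hcommN g ρ⟩
  calc g • h1Eval W (n : ℤ) s ρ = h1Eval W (n : ℤ) s (g * ρ * g⁻¹) := (h1Eval_conj W (n : ℤ) s g hρ).symm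
    _ = h1Eval W (n : ℤ) s (g * ρ * g⁻¹ * ρ⁻¹ * ρ) := by rw [inv_mul_cancel_right]
    _ = h1Eval W (n : ℤ) s ρ := by rw [h1Eval_mul W (n : ℤ) s hc.1 ρ, hs _ hc, zero_add]

/-- **THE SCALAR LEMMA.** On a conjugation-stable subgroup `G' ≤ Γ_{K(E[2^M])}`, if `[c, ·]` vanishes wherever `[h, ·]`
does, then `[c, ·] = a·[h, ·] + b·fn [h, ·]` on `G'` for some `a, b : ℤ`: the values `[h, G']` are spanned over `ℤ[fn]` by
one value `v₁ = [h, ρ₁]` of maximal order (`exists_eq_zsmul_add_zsmul_fn_of_two_pow`), `fn v₁ = [h, ρ₂]` for an explicit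
`ρ₂ ∈ G'` built from a `σ = a' + b'·fn` with `b'` odd, and `[c, ·]` follows `[h, ·]` along `ρ₁^a ρ₂^b`.
[cite: GrossLMS1991, Prop. 9.3] [cite: Rubin1999, Lemma 6.3] -/
theorem exists_h1Eval_eq_zsmul_add_of_ker (G' : Subgroup (absoluteGaloisGroup K))
    (hG' : G' ≤ torsionFixing W (n : ℤ)) (hG'c : ∀ g : absoluteGaloisGroup K, ∀ ρ ∈ G', g * ρ * g⁻¹ ∈ G')
    (h c : galH1Torsion W (n : ℤ))
    (hker : ∀ ρ ∈ G', h1Eval W (n : ℤ) h ρ = 0 → h1Eval W (n : ℤ) c ρ = 0) :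
    ∃ a b : ℤ, ∀ ρ ∈ G', h1Eval W (n : ℤ) c ρ = a • h1Eval W (n : ℤ) h ρ + b • fn (h1Eval W (n : ℤ) h ρ) := by
  -- the exponent `k₀` of the value group `[h, G']`
  have hex : ∃ k : ℕ, ∀ ρ ∈ G', ((2 : ℤ) ^ k) • h1Eval W (n : ℤ) h ρ = 0 :=
    ⟨M, fun ρ _ ↦ two_pow_zsmul_geomTorsion W n hn _⟩
  set k₀ := Nat.find hex with hk₀
  have hk₀spec : ∀ ρ ∈ G', ((2 : ℤ) ^ k₀) • h1Eval W (n : ℤ) h ρ = 0 := Nat.find_spec hex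
  have hk₀M : k₀ ≤ M := Nat.find_le fun ρ _ ↦ two_pow_zsmul_geomTorsion W n hn _
  rcases Nat.eq_zero_or_pos k₀ with hz | hpos
  · -- `[h, ·] = 0` on `G'`, hence `[c, ·] = 0` there
    refine ⟨0, 0, fun ρ hρ ↦ ?_⟩
    have h0 : h1Eval W (n : ℤ) h ρ = 0 := by simpa [hz] using hk₀spec ρ hρ
    rw [hker ρ hρ h0, h0, map_zero, smul_zero, add_zero]
  -- a value `v₁ = [h, ρ₁]` of exact order `2^k₀`
  have hmin : ∃ ρ₁ ∈ G', ((2 : ℤ) ^ (k₀ - 1)) • h1Eval W (n : ℤ) h ρ₁ ≠ 0 := by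
    by_contra hcon
    push Not at hcon
    exact Nat.find_min hex (m := k₀ - 1) (by omega) hcon
  obtain ⟨ρ₁, hρ₁, hv₁⟩ := hmin
  set v₁ := h1Eval W (n : ℤ) h ρ₁ with hv₁def
  set y := h1Eval W (n : ℤ) c ρ₁ with hydef
  -- `y = a v₁ + b fn v₁`
  have hy : ((2 : ℤ) ^ k₀) • y = 0 := by
    have e1 : h1Eval W (n : ℤ) h (ρ₁ ^ ((2 : ℤ) ^ k₀)) = 0 := by
      rw [h1Eval_zpow_of_mem W n h (hG' hρ₁), hk₀spec ρ₁ hρ₁]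
    have e2 := hker _ (Subgroup.zpow_mem _ hρ₁ _) e1
    rwa [h1Eval_zpow_of_mem W n c (hG' hρ₁)] at e2
  obtain ⟨a, b, hab⟩ := exists_eq_zsmul_add_zsmul_fn_of_two_pow W n fn hn hrel hk₀M (hk₀spec ρ₁ hρ₁) hv₁ hy
  -- `ρ₂ ∈ G'` with `[h, ρ₂] = fn v₁` and `[c, ρ₂] = fn y`
  obtain ⟨σ, a', b', hσ, hb'⟩ := exists_smul_eq_zsmul_add_odd_zsmul_fn W n fn hn hM hrel hfn hnofix
  obtain ⟨u, hu⟩ := CMTorsionLine.exists_mul_odd_zsmul_eq (X := geomTorsion W (n : ℤ)) M hb'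
  have hkill := two_pow_zsmul_geomTorsion W n hn
  set ρ₂ := (σ * ρ₁ * σ⁻¹) ^ u * ρ₁ ^ (-(u * a')) with hρ₂def
  have hσρ₁ : σ * ρ₁ * σ⁻¹ ∈ G' := hG'c σ ρ₁ hρ₁
  have hρ₂ : ρ₂ ∈ G' := mul_mem (Subgroup.zpow_mem _ hσρ₁ _) (Subgroup.zpow_mem _ hρ₁ _)
  have hval₂ : ∀ x : galH1Torsion W (n : ℤ), h1Eval W (n : ℤ) x ρ₂ = fn (h1Eval W (n : ℤ) x ρ₁) := by
    intro x
    rw [hρ₂def, h1Eval_mul W (n : ℤ) x (hG' (Subgroup.zpow_mem _ hσρ₁ _)), h1Eval_zpow_of_mem W n x (hG' hσρ₁),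
      h1Eval_zpow_of_mem W n x (hG' hρ₁), h1Eval_conj W (n : ℤ) x σ (hG' hρ₁), hσ]
    have e : u • (a' • h1Eval W (n : ℤ) x ρ₁ + b' • fn (h1Eval W (n : ℤ) x ρ₁)) + -(u * a') • h1Eval W (n : ℤ) x ρ₁ =
        (u * b') • fn (h1Eval W (n : ℤ) x ρ₁) := by module
    rw [e, hu _ (hkill _)]
  -- conclusion along `ρ₁^c₁ ρ₂^d₁`
  refine ⟨a, b, fun ρ hρ ↦ ?_⟩
  obtain ⟨c₁, d₁, hcd⟩ :=
    exists_eq_zsmul_add_zsmul_fn_of_two_pow W n fn hn hrel hk₀M (hk₀spec ρ₁ hρ₁) hv₁ (hk₀spec ρ hρ)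
  set ρ₃ := ρ₁ ^ c₁ * ρ₂ ^ d₁ with hρ₃def
  have hρ₃ : ρ₃ ∈ G' := mul_mem (Subgroup.zpow_mem _ hρ₁ _) (Subgroup.zpow_mem _ hρ₂ _)
  have hval₃ : ∀ x : galH1Torsion W (n : ℤ),
      h1Eval W (n : ℤ) x ρ₃ = c₁ • h1Eval W (n : ℤ) x ρ₁ + d₁ • fn (h1Eval W (n : ℤ) x ρ₁) := fun x ↦ by
    rw [hρ₃def, h1Eval_mul W (n : ℤ) x (hG' (Subgroup.zpow_mem _ hρ₁ _)), h1Eval_zpow_of_mem W n x (hG' hρ₁),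
      h1Eval_zpow_of_mem W n x (hG' hρ₂), hval₂]
  have hh3 : h1Eval W (n : ℤ) h (ρ * ρ₃⁻¹) = 0 := by
    rw [h1Eval_mul W (n : ℤ) h (hG' hρ), h1Eval_inv W (n : ℤ) h (hG' hρ₃), hval₃, ← hcd, add_neg_cancel]
  have hc3 := hker _ (mul_mem hρ (inv_mem hρ₃)) hh3
  rw [h1Eval_mul W (n : ℤ) c (hG' hρ), h1Eval_inv W (n : ℤ) c (hG' hρ₃), hval₃, add_neg_eq_zero] at hc3
  rw [hc3, hcd, ← hydef, hab]
  simp only [map_add, map_zsmul, smul_add, smul_smul]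
  module

variable (N : Subgroup (absoluteGaloisGroup K)) (hcommN : ∀ g ρ : absoluteGaloisGroup K, g * ρ * g⁻¹ * ρ⁻¹ ∈ N)
  (wH : galH1Torsion W (n : ℤ) →+ galH1Torsion W (n : ℤ))
  (hwH : ∀ x, ∀ ρ ∈ torsionFixing W (n : ℤ), h1Eval W (n : ℤ) (wH x) ρ = fn (h1Eval W (n : ℤ) x ρ))
include hcommN hwH

/-- ★ **DOUBLE ANNIHILATOR.** A class `c` vanishing at every `ρ ∈ Γ_{K(E[2^M])} ∩ N` that kills the finite set `T` lies in
the `ℤ[fn]`-span `closure (T ∪ wH '' T)` (induction on `T`: by the scalar lemma `c - (a•h + b•wH h)` vanishes where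
`T` does). [cite: Rubin1999, Lemma 6.3, Prop. 6.5] [cite: GrossLMS1991, Prop. 9.3] [cite: McCallumLMS1991, §5 Prop. 5.2] -/
theorem mem_closure_of_forall_h1Eval_eq_zero (T : Finset (galH1Torsion W (n : ℤ))) (c : galH1Torsion W (n : ℤ))
    (hc : ∀ ρ ∈ torsionFixing W (n : ℤ) ⊓ N, (∀ t ∈ T, h1Eval W (n : ℤ) t ρ = 0) → h1Eval W (n : ℤ) c ρ = 0) :
    c ∈ AddSubgroup.closure ((T : Set (galH1Torsion W (n : ℤ))) ∪ wH '' (T : Set (galH1Torsion W (n : ℤ)))) := by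
  induction T using Finset.induction_on generalizing c with
  | empty =>
    have h0 : c = 0 := eq_zero_of_forall_h1Eval_inf_eq_zero W n fn hn hM hrel hfn hnofix N hcommN
      fun ρ hρ ↦ hc ρ hρ (by simp)
    rw [h0]; exact zero_mem _
  | @insert h T hhT ih =>
    -- `G' = {ρ ∈ Γ_{K(E[n])} ∩ N | [t, ρ] = 0 for t ∈ T}`
    let G' : Subgroup (absoluteGaloisGroup K) :=
      { carrier := {ρ | ρ ∈ torsionFixing W (n : ℤ) ⊓ N ∧ ∀ t ∈ T, h1Eval W (n : ℤ) t ρ = 0}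
        one_mem' := ⟨one_mem _, fun t _ ↦ h1Eval_one W (n : ℤ) t⟩
        mul_mem' := by
          rintro a b ⟨ha, ha'⟩ ⟨hb, hb'⟩
          exact ⟨mul_mem ha hb, fun t ht ↦ by rw [h1Eval_mul W (n : ℤ) t ha.1, ha' t ht, hb' t ht, add_zero]⟩
        inv_mem' := by
          rintro a ⟨ha, ha'⟩
          exact ⟨inv_mem ha, fun t ht ↦ by rw [h1Eval_inv W (n : ℤ) t ha.1, ha' t ht, neg_zero]⟩ }
    have hG' : G' ≤ torsionFixing W (n : ℤ) := fun ρ hρ ↦ hρ.1.1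
    have hG'c : ∀ g : absoluteGaloisGroup K, ∀ ρ ∈ G', g * ρ * g⁻¹ ∈ G' := by
      rintro g ρ ⟨hρ, hρ'⟩
      refine ⟨⟨(torsionFixing_normal W (n : ℤ)).conj_mem ρ hρ.1 g, ?_⟩, fun t ht ↦ ?_⟩
      · rw [← inv_mul_cancel_right (g * ρ * g⁻¹) ρ]; exact mul_mem (hcommN g ρ) hρ.2
      · rw [h1Eval_conj W (n : ℤ) t g hρ.1, hρ' t ht, smul_zero]
    have hker : ∀ ρ ∈ G', h1Eval W (n : ℤ) h ρ = 0 → h1Eval W (n : ℤ) c ρ = 0 := by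
      rintro ρ ⟨hρ, hρ'⟩ hh
      refine hc ρ hρ fun t ht ↦ ?_
      rcases Finset.mem_insert.mp ht with rfl | ht
      · exact hh
      · exact hρ' t ht
    obtain ⟨a, b, hab⟩ := exists_h1Eval_eq_zsmul_add_of_ker W n fn hn hM hrel hfn hnofix G' hG' hG'c h c hker
    -- `c' = c - (a•h + b•wH h)` vanishes on `G'`
    have hc' : ∀ ρ ∈ torsionFixing W (n : ℤ) ⊓ N, (∀ t ∈ T, h1Eval W (n : ℤ) t ρ = 0) →
        h1Eval W (n : ℤ) (c - (a • h + b • wH h)) ρ = 0 := by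
      intro ρ hρ hT
      rw [sub_eq_add_neg, h1Eval_add W (n : ℤ) _ _ hρ.1, h1Eval_neg W (n : ℤ) _ hρ.1, h1Eval_add W (n : ℤ) _ _ hρ.1,
        h1Eval_zsmul W (n : ℤ) _ _ hρ.1, h1Eval_zsmul W (n : ℤ) _ _ hρ.1, hwH _ _ hρ.1, hab ρ ⟨hρ, hT⟩, add_neg_eq_zero]
    have hmem := ih (c - (a • h + b • wH h)) hc'
    have hmono : AddSubgroup.closure ((T : Set (galH1Torsion W (n : ℤ))) ∪ wH '' (T : Set _)) ≤
        AddSubgroup.closure (((insert h T : Finset _) : Set (galH1Torsion W (n : ℤ))) ∪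
          wH '' ((insert h T : Finset _) : Set _)) := by
      apply AddSubgroup.closure_mono
      rw [Finset.coe_insert]
      exact Set.union_subset_union (Set.subset_insert _ _) (Set.image_mono (Set.subset_insert _ _))
    have hh : h ∈ AddSubgroup.closure (((insert h T : Finset _) : Set (galH1Torsion W (n : ℤ))) ∪
        wH '' ((insert h T : Finset _) : Set _)) :=
      AddSubgroup.subset_closure (Or.inl (by simp))
    have hwh : wH h ∈ AddSubgroup.closure (((insert h T : Finset _) : Set (galH1Torsion W (n : ℤ))) ∪
        wH '' ((insert h T : Finset _) : Set _)) :=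
      AddSubgroup.subset_closure (Or.inr ⟨h, by simp, rfl⟩)
    have e : c = (c - (a • h + b • wH h)) + (a • h + b • wH h) := by abel
    rw [e]
    exact add_mem (hmono hmem) (add_mem (AddSubgroup.zsmul_mem _ hh a) (AddSubgroup.zsmul_mem _ hwh b))

/-- ★ **PRESCRIBED VALUE.** For a class `h`, a finite `T` and a target `u ∈ E[2^M]` killed by the `ℤ[fn]`-annihilator of `h`
modulo the span of `T` (`hu`), some `ρ ∈ Γ_{K(E[2^M])} ∩ N` kills `T` and has `[h, ρ] = u`: if `2^k` is the exponent of
the values of `h` on the `T`-killing part of `Γ_{K(E[2^M])} ∩ N`, the double annihilator puts `2^k • h` in the span, so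
`2^k • u = 0` and `u` is a `ℤ[fn]`-combination of a value of maximal order and its `fn`-multiple, both attained.
[cite: Rubin1999, Lemma 6.3, Prop. 6.5] [cite: GrossLMS1991, Prop. 9.3] -/
theorem exists_h1Eval_eq_of_closure (T : Finset (galH1Torsion W (n : ℤ))) (h : galH1Torsion W (n : ℤ))
    (u : geomTorsion W (n : ℤ))
    (hu : ∀ a b : ℤ, a • h + b • wH h ∈
      AddSubgroup.closure ((T : Set (galH1Torsion W (n : ℤ))) ∪ wH '' (T : Set (galH1Torsion W (n : ℤ)))) →
      a • u + b • fn u = 0) :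
    ∃ ρ ∈ torsionFixing W (n : ℤ) ⊓ N, (∀ t ∈ T, h1Eval W (n : ℤ) t ρ = 0) ∧ h1Eval W (n : ℤ) h ρ = u := by
  let G' : Subgroup (absoluteGaloisGroup K) :=
    { carrier := {ρ | ρ ∈ torsionFixing W (n : ℤ) ⊓ N ∧ ∀ t ∈ T, h1Eval W (n : ℤ) t ρ = 0}
      one_mem' := ⟨one_mem _, fun t _ ↦ h1Eval_one W (n : ℤ) t⟩
      mul_mem' := by
        rintro a b ⟨ha, ha'⟩ ⟨hb, hb'⟩
        exact ⟨mul_mem ha hb, fun t ht ↦ by rw [h1Eval_mul W (n : ℤ) t ha.1, ha' t ht, hb' t ht, add_zero]⟩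
      inv_mem' := by
        rintro a ⟨ha, ha'⟩
        exact ⟨inv_mem ha, fun t ht ↦ by rw [h1Eval_inv W (n : ℤ) t ha.1, ha' t ht, neg_zero]⟩ }
  have hG' : G' ≤ torsionFixing W (n : ℤ) := fun ρ hρ ↦ hρ.1.1
  have hG'c : ∀ g : absoluteGaloisGroup K, ∀ ρ ∈ G', g * ρ * g⁻¹ ∈ G' := by
    rintro g ρ ⟨hρ, hρ'⟩
    refine ⟨⟨(torsionFixing_normal W (n : ℤ)).conj_mem ρ hρ.1 g, ?_⟩, fun t ht ↦ ?_⟩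
    · rw [← inv_mul_cancel_right (g * ρ * g⁻¹) ρ]; exact mul_mem (hcommN g ρ) hρ.2
    · rw [h1Eval_conj W (n : ℤ) t g hρ.1, hρ' t ht, smul_zero]
  -- the exponent `k₀` of `[h, G']`, and `2^k₀ • u = 0` by the double annihilator
  have hex : ∃ k : ℕ, ∀ ρ ∈ G', ((2 : ℤ) ^ k) • h1Eval W (n : ℤ) h ρ = 0 :=
    ⟨M, fun ρ _ ↦ two_pow_zsmul_geomTorsion W n hn _⟩
  set k₀ := Nat.find hex with hk₀
  have hk₀spec : ∀ ρ ∈ G', ((2 : ℤ) ^ k₀) • h1Eval W (n : ℤ) h ρ = 0 := Nat.find_spec hex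
  have hk₀M : k₀ ≤ M := Nat.find_le fun ρ _ ↦ two_pow_zsmul_geomTorsion W n hn _
  have hspan : ((2 : ℤ) ^ k₀) • h ∈
      AddSubgroup.closure ((T : Set (galH1Torsion W (n : ℤ))) ∪ wH '' (T : Set (galH1Torsion W (n : ℤ)))) :=
    mem_closure_of_forall_h1Eval_eq_zero W n fn hn hM hrel hfn hnofix N hcommN wH hwH T _ fun ρ hρ hT ↦ by
      rw [h1Eval_zsmul W (n : ℤ) _ _ hρ.1]; exact hk₀spec ρ ⟨hρ, hT⟩
  have hu0 : ((2 : ℤ) ^ k₀) • u = 0 := by simpa using hu ((2 : ℤ) ^ k₀) 0 (by simpa using hspan)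
  rcases Nat.eq_zero_or_pos k₀ with hz | hpos
  · refine ⟨1, one_mem _, fun t _ ↦ h1Eval_one W (n : ℤ) t, ?_⟩
    rw [h1Eval_one]; rw [hz, pow_zero, one_smul] at hu0; exact hu0.symm
  have hmin : ∃ ρ₁ ∈ G', ((2 : ℤ) ^ (k₀ - 1)) • h1Eval W (n : ℤ) h ρ₁ ≠ 0 := by
    by_contra hcon
    push Not at hcon
    exact Nat.find_min hex (m := k₀ - 1) (by omega) hcon
  obtain ⟨ρ₁, hρ₁, hv₁⟩ := hmin
  obtain ⟨a, b, hab⟩ := exists_eq_zsmul_add_zsmul_fn_of_two_pow W n fn hn hrel hk₀M (hk₀spec ρ₁ hρ₁) hv₁ hu0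
  -- `ρ₂ ∈ G'` with `[h, ρ₂] = fn [h, ρ₁]`
  obtain ⟨σ, a', b', hσ, hb'⟩ := exists_smul_eq_zsmul_add_odd_zsmul_fn W n fn hn hM hrel hfn hnofix
  obtain ⟨u', hu'⟩ := CMTorsionLine.exists_mul_odd_zsmul_eq (X := geomTorsion W (n : ℤ)) M hb'
  have hkill := two_pow_zsmul_geomTorsion W n hn
  set ρ₂ := (σ * ρ₁ * σ⁻¹) ^ u' * ρ₁ ^ (-(u' * a')) with hρ₂def
  have hσρ₁ : σ * ρ₁ * σ⁻¹ ∈ G' := hG'c σ ρ₁ hρ₁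
  have hρ₂ : ρ₂ ∈ G' := mul_mem (Subgroup.zpow_mem _ hσρ₁ _) (Subgroup.zpow_mem _ hρ₁ _)
  have hval₂ : h1Eval W (n : ℤ) h ρ₂ = fn (h1Eval W (n : ℤ) h ρ₁) := by
    rw [hρ₂def, h1Eval_mul W (n : ℤ) h (hG' (Subgroup.zpow_mem _ hσρ₁ _)), h1Eval_zpow_of_mem W n h (hG' hσρ₁),
      h1Eval_zpow_of_mem W n h (hG' hρ₁), h1Eval_conj W (n : ℤ) h σ (hG' hρ₁), hσ]
    have e : u' • (a' • h1Eval W (n : ℤ) h ρ₁ + b' • fn (h1Eval W (n : ℤ) h ρ₁)) + -(u' * a') • h1Eval W (n : ℤ) h ρ₁ =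
        (u' * b') • fn (h1Eval W (n : ℤ) h ρ₁) := by module
    rw [e, hu' _ (hkill _)]
  refine ⟨ρ₁ ^ a * ρ₂ ^ b, (mul_mem (Subgroup.zpow_mem _ hρ₁ _) (Subgroup.zpow_mem _ hρ₂ _) : _ ∈ G').1,
    (mul_mem (Subgroup.zpow_mem _ hρ₁ _) (Subgroup.zpow_mem _ hρ₂ _) : _ ∈ G').2, ?_⟩
  rw [h1Eval_mul W (n : ℤ) h (hG' (Subgroup.zpow_mem _ hρ₁ _)), h1Eval_zpow_of_mem W n h (hG' hρ₁),
    h1Eval_zpow_of_mem W n h (hG' hρ₂), hval₂, ← hab]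

end Kummer

end Literature.NumberTheory.EllipticCurves.JZero

end
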